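import Literature.Analysis.FluidPDE.SuitableWeak
import Literature.Analysis.FluidPDE.AxisymmetricEuler
import Literature.Analysis.UnboundedOperators.HeatKernel
import HarnessLib

/-!
# Seregin–Zhou 2020: `L^∞(0,T; Ḃ^{-1}_{∞,∞})` suitable weak solutions have bounded scaled
# energies; axially symmetric ones have no singular points

Topic `Literature/Analysis/FluidPDE`; the hypotheses of Seregin–Zhou's Theorem 1.2
(`HeatBesovBound`, `FiniteEnergyClassUpTo`, `Hypotheses`) and ONE named fact (result in print,
`def … : Prop`, D-0014), the axisymmetric corollary `axisymmetric_regular`, requested by `wi-08119`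
for route `NavierStokesRegularity/SwirlSignGeometry` (support item `PoloidalCirculationCriterion`
= `stmt-NavierStokesRegularity-1138`), over the tree's `IsSuitableWeakSolutionOn`,
`HasWeakSpatialGradientOn`, the scaled quantities `cknA`, `cknE`, `cknC` (`SuitableWeak.lean`),
`IsAxisymmetric` (`AxisymmetricEuler.lean`) and the caloric extension
`heatExtension f s = heatKernel s ⋆ f` (`UnboundedOperators/HeatKernel.lean`). Theorem 1.2 itself
is PROVED downstream in its faithful form (`SereginZhou2020.scaledEnergiesEss_lt_top`,
`SereginZhou2020ScaledEnergies.lean`); the original rendering `scaledEnergies_lt_top` of this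
file is refuted and survives only as a `@[deprecated]` tombstone (verdict clean-up below).

G. Seregin, D. Zhou, *Regularity of solutions to the Navier–Stokes equations in
`Ḃ^{-1}_{∞,∞}`*, J. Math. Sci. 244 (2020) = arXiv:1802.03600 (held, read in full):

* **Definition 1.1** (suitable weak solution in `Q_T = Ω × ]0,T[`, here `Ω = ℝ³`, `ν = 1`):
  (i) `v ∈ L_∞(δ,T; L_{2,loc}) ∩ L₂(δ,T; W¹_{2,loc})`, `q ∈ L_{3/2}(δ,T; L_{3/2,loc})` for every
  `δ ∈ ]0,T]`; (ii) Navier–Stokes in the sense of distributions; (iii) the local energy inequality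
  on cylinders `Q(z₀,R) ⊂ Ω × ]0,T[` for a.a. `t`.
* Scaled energies (p. 2): `A(z₀,r) = sup_{t₀−r²<t<t₀} r⁻¹∫_{B(x₀,r)}|v|²`,
  `E(z₀,r) = r⁻¹∫_{Q(z₀,r)}|∇v|²`, `C(z₀,r) = r⁻²∫_{Q(z₀,r)}|v|³` (and `D`), `Q(z₀,r) = B(x₀,r) ×
  ]t₀−r², t₀[` — the tree's `cknA`, `cknE`, `cknC` with `z = (t₀, x₀)` (time first).
* `‖f‖_{Ḃ^{-1}_{∞,∞}} := sup_{t>0} t^{1/2}‖w(·,t)‖_{L_∞}`, `w` the caloric extension of `f` (p. 2).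
* **Theorem 1.2.** `Ω = ℝ³`; `(v, q)` suitable in `Q_T` with `v ∈ L_∞(0,T; Ḃ^{-1}_{∞,∞}(ℝ³))`
  ((1.1)). Then for every `z₀ ∈ ℝ³ × ]0,T]`:
  `sup_{0<r<r₀} max{A,E,C}(z₀,r) ≤ c[r₀^{1/2} + ‖v‖² + ‖v‖⁶]`, `r₀ ≤ ½ min{1,t₀}`, `c` depending on
  `C(z₀,1)`, `D(z₀,1)` only. In particular (abstract) "all scaled energy quantities of `u` are
  bounded" and (Def 1.3 ff.) such solutions have Type I singularities only.
* **Corollary** (abstract; §1 after Def. 1.3): "any axially symmetric suitable weak solution `u`,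
  belonging to `L_∞(0,T; Ḃ^{-1}_{∞,∞})`, is smooth" — by Seregin 2012, axially symmetric suitable
  weak solutions have no Type I blow-ups, and by Thm 1.2 there are no others: no point of
  `ℝ³ × ]0,T]` is singular in the sense of Def. 1.3 ("there is no parabolic vicinity of `z₀` where
  `v` is bounded").

## Rendering (each deviation goes in the SAFE direction: stronger hypotheses / weaker conclusion)

* Suitability: the tree's `IsSuitableWeakSolutionOn (slab ℝ³ (Ioo 0 T)) 1 0 v q` (CKN/Lin form:
  distributional solution, local `L^∞_tL²_x`, `∇v ∈ L²_loc`, `q ∈ L^{3/2}_loc`, integrated local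
  energy inequality for all nonnegative `φ ∈ C_c^∞`, equivalent to the a.e.-`t` form (iii)) PLUS
  Def. 1.1 (i) up to the final time as the explicit hypothesis `FiniteEnergyClassUpTo T v G q`
  (for every `δ > 0` and every ball: `ess sup_{(δ,T)} ∫_B |v|² < ∞`, `∫_δ^T∫_B |G|² < ∞`,
  `∫_δ^T∫_B |q|^{3/2} < ∞`), `G` a weak spatial gradient of `v` on the slab
  (`HasWeakSpatialGradientOn`, the tree's `∇v`; weak gradients are a.e. unique).
* Hypothesis (1.1): `∃ M, for a.e. t ∈ (0,T), HeatBesovBound M (v t)`, where `HeatBesovBound M f`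
  asks `√s · ‖(heatKernel s ⋆ f)(x)‖ ≤ M` for all `s > 0`, `x`, TOGETHER WITH absolute convergence
  of the convolution integral (no Bochner junk): slightly stronger than membership of the tempered
  distribution `v(t)` in `Ḃ^{-1}_{∞,∞}` with norm `≤ M`, automatic for `v(t) ∈ L²(ℝ³)`.
* Conclusion of Thm 1.2: the QUALITATIVE form "all scaled energies are bounded" — for every
  `t₀ ∈ (0,T]`, `x₀`, the suprema of `A`, `E`, `C` over `0 < r < ½ min{1,t₀}` are finite (the
  explicit majorant `c[r₀^{1/2} + ‖v‖² + ‖v‖⁶]` with `c = c(C(z₀,1), D(z₀,1))` is not transcribed).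
  **This deviation did NOT go in the safe direction and the rendering is mis-stated:** the
  paper's `A(z₀,r) = sup_{t₀−r²<t<t₀} r⁻¹∫_{B(x₀,r)}|v|²` for `v ∈ L_∞(δ,T;L_{2,loc})` (Def. 1.1
  (i)) is an ESSENTIAL supremum in `t`, whereas the tree's `cknA` takes a GENUINE `⨆` over `t`
  (design notes of `SuitableWeak.lean`) while every hypothesis in `Hypotheses` sees `v` only for
  a.e. `t` / through space–time integrals. Redefining `v ≡ 0` on the rational times
  (`v t x = 𝟙_ℚ(t)(1-t)⁻¹e₀`, `q = 0`, `G = 0`, `T = 1`) keeps all hypotheses and gives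
  `cknA (1/4) (1,0) v = ⊤`: `scaledEnergies_lt_top` is FALSE, refuted sorry-free as
  `SereginZhou2020.not_scaledEnergies_lt_top`
  (`Literature/Analysis/FluidPDE/SereginZhou2020Counterexample.lean`). The faithful rendering is
  the same statement with `cknA` replaced by the tree's essential-supremum quantity `cknAEss`
  (`Literature/Analysis/FluidPDE/LocalTypeI.lean`, Albritton–Barker's `A`), everything else
  verbatim; it is the printed Thm 1.2 and is PROVED as the theorem
  `SereginZhou2020.scaledEnergiesEss_lt_top`
  (`Literature/Analysis/FluidPDE/SereginZhou2020ScaledEnergies.lean`, with the corollaries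
  `Hypotheses.limsup_cknC_lt_top` — Type I only — and `Hypotheses.exists_scaledEnergies_le`;
  Lemma 2.4 (C) is `SereginZhou2020CubicEstimate.lean`). Use the theorem; see the verdict
  clean-up below for what is left of the def.
* Corollary: "smooth" is rendered as Def. 1.3-regularity at every point of `ℝ³ × ]0,T]`: `v` is
  essentially bounded on some backward parabolic cylinder `Q(z₀,r) = ]t₀−r², t₀[ × B(x₀,r)`
  (`parabolicCylinder`, inside the slab also for `t₀ = T`); axial symmetry about the `x₂`-axis
  for a.e. time slice (`IsAxisymmetric`, the tree's convention; any axis in the paper).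

## Verdict clean-up (2026-08-16): `scaledEnergies_lt_top` retired from the named-fact debt

The tenured prove seat of `scaledEnergies_lt_top` returned *refuted as rendered* (the negation
is the sorry-free theorem `SereginZhou2020.not_scaledEnergies_lt_top` of
`Literature.Analysis.FluidPDE.SereginZhou2020Counterexample`, also written out in full there as
`SereginZhou2020.not_forall_hypotheses_cknA_lt_top`) and the faithful statement — the same
sentence with `cknA` replaced by `cknAEss` — is the proved theorem
`SereginZhou2020.scaledEnergiesEss_lt_top`. Re-verified for this clean-up against the source
(arXiv:1802.03600, §1: Def. 1.1 (i) "`v ∈ L_∞(δ,T; L_{2,loc}(Ω)) ∩ L₂(δ,T; W¹_{2,loc}(Ω))` …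
for any `δ ∈ ]0,T]`", so the `sup_{t₀−r²<t<t₀}` in the display defining `A(z₀,r)` right after
Def. 1.1 is taken on an `L_∞(δ,T; ·)` class — an essential supremum — and Thm 1.2 bounds
`sup_{0<r<r₀} max{A,E,C}(z₀,r)` for such `v`) and against the tree (both theorems present and
sorry-free). Accordingly:
* the constant `scaledEnergies_lt_top` is **kept verbatim** (name and body: its refutation
  `not_scaledEnergies_lt_top : ¬ scaledEnergies_lt_top` names it and must keep type-checking) but
  is `@[deprecated]`, its docstring a tombstone naming the refuting theorem and the proved
  replacement; it is no longer a vendored fact of this file and nothing but its refutation may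
  mention it (the refuting file silences the deprecation linter on exactly that declaration).
  It can be deleted outright once `not_scaledEnergies_lt_top` is restated over the written-out
  sentence (it would then coincide with `not_forall_hypotheses_cknA_lt_top`);
* its two API lemmas `scaledEnergies_lt_top.at_final_time` and `scaledEnergies_lt_top.cknA_lt_top`
  (implications with the refuted constant as hypothesis, hence vacuous; no user in the tree) are
  **deleted**. Their honest counterparts are `scaledEnergiesEss_lt_top` applied at
  `t₀ = T` and `Hypotheses.exists_scaledEnergies_le` (`SereginZhou2020ScaledEnergies.lean`);
* no corrected `def` is re-declared here: the corrected statement is already a theorem of the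
  tree, and re-vendoring it as a `Prop` would only duplicate that declaration.

## References

* G. Seregin, D. Zhou, *Regularity of solutions to the Navier–Stokes equations in
  `Ḃ^{-1}_{∞,∞}`*, Zap. Nauchn. Sem. POMI 477 (2018) / J. Math. Sci. 244 (2020) 1003–1009,
  arXiv:1802.03600: Def. 1.1, scaled energies, Thm 1.2, Def. 1.3 and the axisymmetric remark,
  abstract. [`SereginZhou2020`]
* G. Seregin, *A certain necessary condition of potential blow up for Navier–Stokes equations*,
  Comm. Math. Phys. 312 (2012) (axisymmetric solutions have no Type I blow-up). [`Seregin2012`]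
-/

noncomputable section

open MeasureTheory Set Metric Function
open scoped ENNReal NNReal Convolution
open Literature.Analysis.UnboundedOperators

namespace Literature.Analysis.FluidPDE

/-- Local notation for physical space `ℝ³ = EuclideanSpace ℝ (Fin 3)`. -/
local notation "ℝ³" => EuclideanSpace ℝ (Fin 3)

namespace SereginZhou2020

/-! ### The hypotheses of Theorem 1.2 -/

/-- **`Ḃ^{-1}_{∞,∞}` bound via the heat flow** (Seregin–Zhou 2020, p. 2:
`‖f‖_{Ḃ^{-1}_{∞,∞}} = sup_{s>0} s^{1/2} ‖w(·,s)‖_{L_∞}`, `w` the caloric extension of `f`):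
`HeatBesovBound M f` says that for every `s > 0` and `x` the convolution integral
`(heatKernel s ⋆ f)(x) = ∫ heatKernel s y • f(x − y) dy` converges absolutely and
`√s · ‖(heatKernel s ⋆ f)(x)‖ ≤ M` (`heatExtension`, `UnboundedOperators/HeatKernel.lean`). The
integrability clause removes the Bochner junk value; it makes the predicate slightly STRONGER than
"`‖f‖_{Ḃ^{-1}_{∞,∞}} ≤ M` for the tempered distribution `f`" and is automatic for `f ∈ L²(ℝ³)`.
[cite: SereginZhou2020, §1 (definition of the Ḃ^{-1}_{∞,∞} norm, p. 2)] -/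
def HeatBesovBound (M : ℝ) (f : ℝ³ → ℝ³) : Prop :=
  ∀ s : ℝ, 0 < s → ∀ x : ℝ³,
    Integrable (fun y : ℝ³ => heatKernel s y • f (x - y)) ∧
      Real.sqrt s * ‖heatExtension f s x‖ ≤ M

/-- **Definition 1.1 (i) up to the final time** (Seregin–Zhou 2020, Def. 1.1 (i) with `Ω = ℝ³`:
`v ∈ L_∞(δ,T; L_{2,loc}) ∩ L₂(δ,T; W¹_{2,loc})`, `q ∈ L_{3/2}(δ,T; L_{3/2,loc})` for every
`δ ∈ ]0,T]`), written with a weak spatial gradient `G` of `v` in place of `∇v`: for every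
`0 < δ < T` and every ball `B(x,R)`, the spatial `L²` energy of `v` on the ball is essentially
bounded over `t ∈ (δ,T)`, and `|G|²`, `|q|^{3/2}` are integrable on `(δ,T) × B(x,R)`. (The tree's
`IsSuitableWeakSolutionOn` only controls compact subsets of the OPEN slab, i.e. times bounded away
from `T`; Thm 1.2 at `t₀ = T` needs the class up to `T`.) [cite: SereginZhou2020, Def. 1.1 (i)] -/
def FiniteEnergyClassUpTo (T : ℝ) (v : ℝ → ℝ³ → ℝ³) (G : ℝ → ℝ³ → ℝ³ →L[ℝ] ℝ³)
    (q : ℝ → ℝ³ → ℝ) : Prop :=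
  ∀ δ : ℝ, 0 < δ → δ < T → ∀ (x : ℝ³) (R : ℝ), 0 < R →
    (∃ C : ℝ≥0, ∀ᵐ t : ℝ, t ∈ Ioo δ T → ∫⁻ y in ball x R, ‖v t y‖ₑ ^ 2 ≤ C) ∧
    (∫⁻ z in Ioo δ T ×ˢ ball x R, ENNReal.ofReal (frobeniusNormSq (G z.1 z.2)) < ∞) ∧
    (∫⁻ z in Ioo δ T ×ˢ ball x R, ‖q z.1 z.2‖ₑ ^ (3 / 2 : ℝ) < ∞)

/-- The standing hypotheses of Seregin–Zhou 2020, Thm 1.2, bundled: `T > 0`; `(v, q)` a suitable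
weak solution of Navier–Stokes (`ν = 1`, no force) on the slab `(0,T) × ℝ³` in the tree's sense;
`G` a weak spatial gradient of `v` there; the energy class of Def. 1.1 (i) up to `T`; and
`v ∈ L_∞(0,T; Ḃ^{-1}_{∞,∞}(ℝ³))` ((1.1)): a uniform heat-flow bound for a.e. time slice.
[cite: SereginZhou2020, Def. 1.1 and Thm 1.2 (hypotheses, (1.1))] -/
structure Hypotheses (T : ℝ) (v : ℝ → ℝ³ → ℝ³) (q : ℝ → ℝ³ → ℝ)
    (G : ℝ → ℝ³ → ℝ³ →L[ℝ] ℝ³) : Prop where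
  /-- The final time is positive. -/
  pos : 0 < T
  /-- Suitable weak solution on `(0,T) × ℝ³` (CKN/Lin form, `ν = 1`, `f = 0`). -/
  suitable : IsSuitableWeakSolutionOn (slab ℝ³ (Ioo 0 T) isOpen_Ioo) 1 0 v q
  /-- `G = ∇v` weakly on the slab. -/
  weakGradient : HasWeakSpatialGradientOn (slab ℝ³ (Ioo 0 T) isOpen_Ioo) v G
  /-- Def. 1.1 (i) up to the final time. -/
  energyClass : FiniteEnergyClassUpTo T v G q
  /-- (1.1): `ess sup_{0<t<T} ‖v(t)‖_{Ḃ^{-1}_{∞,∞}} < ∞`. -/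
  besov : ∃ M : ℝ, ∀ᵐ t : ℝ, t ∈ Ioo 0 T → HeatBesovBound M (v t)

/-! ### Theorem 1.2: the refuted original rendering (deprecated) and the axisymmetric corollary
(named fact) -/

/-- **Deprecated — refuted as rendered; kept verbatim (name and body) only as the subject of its
refutation `SereginZhou2020.not_scaledEnergies_lt_top`
(`Literature.Analysis.FluidPDE.SereginZhou2020Counterexample`). Use the proved, faithful
Theorem 1.2 `SereginZhou2020.scaledEnergiesEss_lt_top`
(`Literature.Analysis.FluidPDE.SereginZhou2020ScaledEnergies`) instead; no
`scaledEnergies_lt_top_holds` can exist and nothing may take this constant as a hypothesis.**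

*What it says.* The first transcription of Seregin–Zhou 2020, Thm 1.2 in its qualitative form
("all scaled energies are bounded"): under `Hypotheses T v q G` (suitable weak solution of
Navier–Stokes on `ℝ³ × ]0,T[` in the energy class of Def. 1.1 (i) up to `T`, `G = ∇v` weakly,
`v ∈ L_∞(0,T; Ḃ^{-1}_{∞,∞})`), for every `z₀ = (t₀, x₀)` with `t₀ ∈ ]0,T]` and
`r₀ = ½ min{1, t₀}`, the suprema over `0 < r < r₀` of the tree's `cknA r z₀ v`, `cknE r z₀ G`,
`cknC r z₀ v` are finite. (Printed: `sup_{0<r<r₀} max{A,E,C}(z₀,r) ≤ c[r₀^{1/2} +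
‖v‖²_{L_∞Ḃ^{-1}_{∞,∞}} + ‖v‖⁶_{L_∞Ḃ^{-1}_{∞,∞}}]`, `r₀ ≤ ½min{1,t₀}`, `c = c(C(z₀,1), D(z₀,1))`.)

*What is wrong.* `cknA r (t₀,x₀) v = ⨆_{t ∈ (t₀−r², t₀)} r⁻¹ ∫_{B(x₀,r)} |v t|²` is a GENUINE
supremum over the times (`SuitableWeak.lean`, design notes), whereas every clause of `Hypotheses`
sees `v` only through space–time integrals and `∀ᵐ t` statements; modifying a solution on a null
set of times keeps all hypotheses and destroys the conclusion: `v t x = 𝟙_ℚ(t)(1-t)⁻¹e₀`, `q = 0`,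
`G = 0`, `T = 1` satisfy `Hypotheses 1 v 0 0` while `cknA (1/4) (1,0) v = ⊤` and
`1/4 ∈ (0, ½ min{1,1})`. In the paper `v ∈ L_∞(δ,T; L_{2,loc}(Ω))` for every `δ ∈ ]0,T]`
(Def. 1.1 (i)), so the `sup_{t₀−r²<t<t₀}` defining `A(z₀,r)` is an ESSENTIAL supremum: the
printed theorem is not at fault, the transcription of `A` is.

*Refutation (kept):* `SereginZhou2020.not_scaledEnergies_lt_top : ¬ scaledEnergies_lt_top`, and
the same negation with the sentence written out in full,
`SereginZhou2020.not_forall_hypotheses_cknA_lt_top` (both in `SereginZhou2020Counterexample.lean`).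
*Corrected statement (proved, not re-declared here):* `SereginZhou2020.scaledEnergiesEss_lt_top`
— this very sentence with `cknA` replaced by the essential-supremum energy `cknAEss`
(`LocalTypeI.lean`, Albritton–Barker's `A`), `cknE`, `cknC` verbatim — with the corollaries
`Hypotheses.limsup_cknC_lt_top` (Type I singularities only) and
`Hypotheses.exists_scaledEnergies_le` (`SereginZhou2020ScaledEnergies.lean`).
[cite: SereginZhou2020, Thm 1.2 — mis-rendered (genuine sup in A) and refuted in-tree: tombstone] -/
@[deprecated "refuted as rendered (genuine sup over t in cknA versus a.e.-in-time hypotheses): \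
    see Literature.Analysis.FluidPDE.SereginZhou2020.not_scaledEnergies_lt_top \
    (SereginZhou2020Counterexample.lean); the faithful Thm 1.2 is PROVED as \
    Literature.Analysis.FluidPDE.SereginZhou2020.scaledEnergiesEss_lt_top \
    (SereginZhou2020ScaledEnergies.lean)" (since := "2026-08-16")]
def scaledEnergies_lt_top : Prop :=
  ∀ (T : ℝ) (v : ℝ → ℝ³ → ℝ³) (q : ℝ → ℝ³ → ℝ) (G : ℝ → ℝ³ → ℝ³ →L[ℝ] ℝ³),
    Hypotheses T v q G → ∀ t₀ ∈ Ioc 0 T, ∀ x₀ : ℝ³,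
      (⨆ r ∈ Ioo 0 (min 1 t₀ / 2), cknA r (t₀, x₀) v) < ∞ ∧
      (⨆ r ∈ Ioo 0 (min 1 t₀ / 2), cknE r (t₀, x₀) G) < ∞ ∧
      (⨆ r ∈ Ioo 0 (min 1 t₀ / 2), cknC r (t₀, x₀) v) < ∞

/-- **Seregin–Zhou 2020, corollary (abstract; §1 after Def. 1.3): axially symmetric
`L_∞(0,T; Ḃ^{-1}_{∞,∞})` suitable weak solutions are regular.** Under `Hypotheses T v q G`, if
moreover a.e. time slice `v(t)` is axisymmetric (about the `x₂`-axis, `IsAxisymmetric`), then no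
point of `ℝ³ × ]0,T]` is singular in the sense of Def. 1.3: for every `t₀ ∈ ]0,T]` and `x₀` there
is `r > 0` with `v` essentially bounded on the backward parabolic cylinder
`Q(z₀,r) = ]t₀−r², t₀[ × B(x₀,r)` ("there is [a] parabolic vicinity of `z₀` where `v` is
bounded"). Printed: "any axially symmetric suitable weak solution `u`, belonging to
`L_∞(0,T; Ḃ^{-1}_{∞,∞})`, is smooth" — Thm 1.2 leaves Type I singularities only, and axially
symmetric suitable weak solutions have no Type I blow-ups (Seregin 2012). Not proved here.
[cite: SereginZhou2020, abstract and §1 (remark after Def. 1.3)] -/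
def axisymmetric_regular : Prop :=
  ∀ (T : ℝ) (v : ℝ → ℝ³ → ℝ³) (q : ℝ → ℝ³ → ℝ) (G : ℝ → ℝ³ → ℝ³ →L[ℝ] ℝ³),
    Hypotheses T v q G → (∀ᵐ t : ℝ, t ∈ Ioo 0 T → IsAxisymmetric (v t)) →
      ∀ t₀ ∈ Ioc 0 T, ∀ x₀ : ℝ³, ∃ r > 0,
        eLpNorm (uncurry v) ∞ (volume.restrict (parabolicCylinder r (t₀, x₀))) < ∞

/-! ### Proved API -/

variable {T : ℝ} {v : ℝ → ℝ³ → ℝ³} {q : ℝ → ℝ³ → ℝ} {G : ℝ → ℝ³ → ℝ³ →L[ℝ] ℝ³}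

/-- A bound `M` for the heat-flow Besov quantity is nonnegative as soon as it holds at one point
(`0 ≤ √s ‖…‖ ≤ M`). [folklore] -/
theorem HeatBesovBound.nonneg {M : ℝ} {f : ℝ³ → ℝ³} (h : HeatBesovBound M f) : 0 ≤ M :=
  le_trans (mul_nonneg (Real.sqrt_nonneg 1) (norm_nonneg _)) (h 1 one_pos 0).2

/-- Monotonicity of the Besov bound in `M`. [folklore] -/
theorem HeatBesovBound.mono {M M' : ℝ} {f : ℝ³ → ℝ³} (h : HeatBesovBound M f) (hM : M ≤ M') :
    HeatBesovBound M' f :=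
  fun s hs x => ⟨(h s hs x).1, (h s hs x).2.trans hM⟩

/-- The radius window of Thm 1.2 is nonempty: `0 < ½ min{1, t₀}` for `t₀ > 0`. [folklore] -/
theorem radius_pos {t₀ : ℝ} (ht₀ : 0 < t₀) : 0 < min 1 t₀ / 2 :=
  half_pos (lt_min one_pos ht₀)

/-- The corollary at the final time: for an axisymmetric solution every point `(T, x₀)` has a
backward parabolic cylinder on which `v` is essentially bounded (no blow-up at `T`), the named
fact being the hypothesis `h`. [cite: SereginZhou2020, abstract (axially symmetric ⇒ smooth)] -/
theorem axisymmetric_regular.at_final_time (h : axisymmetric_regular) (hyp : Hypotheses T v q G)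
    (hax : ∀ᵐ t : ℝ, t ∈ Ioo 0 T → IsAxisymmetric (v t)) (x₀ : ℝ³) :
    ∃ r > 0, eLpNorm (uncurry v) ∞ (volume.restrict (parabolicCylinder r (T, x₀))) < ∞ :=
  h T v q G hyp hax T ⟨hyp.pos, le_rfl⟩ x₀

end SereginZhou2020

end Literature.Analysis.FluidPDE

end
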